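import Literature.Probability.RandomPlanarGeometry.SAWBridgeTwoStepRate
import Literature.Probability.RandomPlanarGeometry.BDGS2012CountBoundsProofs
import HarnessLib

/-!
# The two-step bridge ratio on `ℤ²` with explicit constants:
# `-(21 μ^{4/3} B^{1/3} + 4B + 96 μ²) N^{-1/3} ≤ b_{N+2}/b_N - μ² ≤ (10 μ √B + 37 B) N^{-1/4}`, all `N ≥ 1`

Topic `Literature/Probability/RandomPlanarGeometry` (continues `SAWBridgeTwoStepRate.lean`: the
quantitative Lemma 7.3.1 routines `upper_dev_env`, `lower_dev_supermult` of Madras–Slade, *The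
Self-Avoiding Walk* (1993), run for bridges). Given Kesten's additive inequality for bridges on `ℤ²`
with an explicit constant `B` and ALL `n ≥ 1` (`KestenIneqBridgesZ2 B`, a hypothesis shape to be
discharged by the lane's explicit pattern bounds), the envelope `e^{-12√n} μ^n ≤ b_n ≤ μ^n`
(`bridge_envelope_Z2`, from `count_le_mul_exp_mul_bridgeCount` and `μ ≤ 3`) and supermultiplicativity give
the two-sided rate with CLOSED-FORM constants for every `N ≥ 1`:

* `twoStep_upper_explicit_Z2 : b_{N+2}/b_N - μ² ≤ (10 μ √B + 37 B) N^{-1/4}`;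
* `twoStep_lower_explicit_Z2 : -(21 μ^{4/3} B^{1/3} + 4B + 96 μ²) N^{-1/3} ≤ b_{N+2}/b_N - μ²`

— the asymmetric exponents printed by Kesten for `c_N(0,x)` (Madras–Slade (7.5.2)); no rate for
(7.3.13) is printed.
-/

noncomputable section

open Filter Topology Finset Literature.Probability.LatticeModels Literature.Probability.Percolation SimpleGraph
open scoped BigOperators

namespace Literature.Probability.RandomPlanarGeometry.SAW.Zd

/-- Kesten's ratio inequality for BRIDGES on `ℤ²` with an explicit constant and every `n ≥ 1`
(the shape `KestenIneqBridgesZ2` of the lane's explicit-rate table; a hypothesis, not a fact).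
[cite: MadrasSlade1993, Theorem 7.3.2(b)] -/
def KestenIneqBridgesZ2 (B : ℝ) : Prop :=
  ∀ n : ℕ, 1 ≤ n →
    (bridgeCount 2 (n + 2) : ℝ) / bridgeCount 2 n - B / n ≤
      (bridgeCount 2 (n + 4) : ℝ) / bridgeCount 2 (n + 2)

/-- `log(1 + x) ≥ x/2` on `[0, 1]`. [folklore] -/
private theorem half_le_log_one_add' {x : ℝ} (hx0 : 0 ≤ x) (hx1 : x ≤ 1) : x / 2 ≤ Real.log (1 + x) := by
  have h := Real.add_one_le_exp (-(Real.log (1 + x)))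
  rw [Real.exp_neg, Real.exp_log (by linarith)] at h
  have h1 : x / (1 + x) ≤ Real.log (1 + x) := by
    rw [div_le_iff₀ (by linarith)]
    have : (1 - Real.log (1 + x)) * (1 + x) ≤ 1 := by
      calc (1 - Real.log (1 + x)) * (1 + x) = (-Real.log (1 + x) + 1) * (1 + x) := by ring
        _ ≤ (1 + x)⁻¹ * (1 + x) := mul_le_mul_of_nonneg_right h (by linarith)
        _ = 1 := inv_mul_cancel₀ (by linarith)
    nlinarith
  have h2 : x / 2 ≤ x / (1 + x) := div_le_div_of_nonneg_left hx0 (by linarith) (by linarith)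
  linarith

/-- `-log(1 - x) ≥ x` for `x < 1`. [folklore] -/
private theorem le_neg_log_one_sub' {x : ℝ} (hx : x < 1) : x ≤ -Real.log (1 - x) := by
  have h := Real.add_one_le_exp (-x)
  have h2 := Real.log_le_log (by linarith : 0 < 1 - x) (by linarith : 1 - x ≤ Real.exp (-x))
  rw [Real.log_exp] at h2; linarith

/-- `μ(ℤ²) ≤ 3`. [cite: MadrasSlade1993, §1.2, eq. (1.2.10)] -/
private theorem mu_two_le_three : connectiveConstant 2 ≤ 3 := by
  have := connectiveConstant_le 2 (by norm_num); norm_num at this; exact this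

/-- **The bridge envelope on `ℤ²` with the constant `12`**: `e^{-12√n} μ^n ≤ b_n` for every `n`
(Madras–Slade Corollary 3.1.6 `μ^N e^{-B√N} ≤ b_N`, from `μ^{n-1} ≤ c_{n-1} ≤ n e^{6√n} b_n` and
`3n ≤ e^{6√n}`). [cite: MadrasSlade1993, Corollary 3.1.6] -/
theorem bridge_envelope_Z2 (n : ℕ) :
    Real.exp (-(12 * Real.sqrt n)) * connectiveConstant 2 ^ n ≤ bridgeCount 2 n := by
  have hμ := connectiveConstant_pos 2
  have hμ3 := mu_two_le_three
  rcases Nat.eq_zero_or_pos n with rfl | hn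
  · have : 1 ≤ bridgeCount 2 0 := one_le_bridgeCount 0
    simp only [Nat.cast_zero, Real.sqrt_zero, mul_zero, neg_zero, Real.exp_zero, pow_zero, one_mul]
    exact_mod_cast this
  obtain ⟨k, rfl⟩ := Nat.exists_eq_succ_of_ne_zero hn.ne'
  have h1 : connectiveConstant 2 ^ k ≤ ((k : ℝ) + 1) * Real.exp (6 * Real.sqrt (k + 1)) * bridgeCount 2 (k + 1) :=
    (pow_connectiveConstant_le_count 2 k).trans (count_le_mul_exp_mul_bridgeCount k)
  set s : ℝ := Real.sqrt ((k : ℝ) + 1) with hs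
  have hs2 : s ^ 2 = (k : ℝ) + 1 := by rw [hs, Real.sq_sqrt (by positivity)]
  have hs0 : 0 ≤ s := Real.sqrt_nonneg _
  -- `3 (k+1) ≤ e^{6 s}` since `e^{3s} ≥ 1 + 3s ≥ 3s` and `(3s)² = 9 (k+1)`
  have hexp : 3 * ((k : ℝ) + 1) ≤ Real.exp (6 * s) := by
    have h3 : 3 * s ≤ Real.exp (3 * s) := by linarith [Real.add_one_le_exp (3 * s)]
    have h4 : Real.exp (6 * s) = Real.exp (3 * s) * Real.exp (3 * s) := by rw [← Real.exp_add]; ring_nf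
    rw [h4]
    have : 3 * s * (3 * s) ≤ Real.exp (3 * s) * Real.exp (3 * s) :=
      mul_le_mul h3 h3 (by positivity) (Real.exp_nonneg _)
    nlinarith
  have hb0 : (0 : ℝ) ≤ bridgeCount 2 (k + 1) := Nat.cast_nonneg _
  have hsk : Real.sqrt (((k + 1 : ℕ) : ℝ)) = s := by rw [hs]; push_cast; ring_nf
  rw [hsk, pow_succ]
  -- `μ^k μ ≤ (k+1) e^{6s} b μ ≤ e^{12 s} b`
  have e1 : connectiveConstant 2 ^ k * connectiveConstant 2 ≤
      ((k : ℝ) + 1) * Real.exp (6 * s) * bridgeCount 2 (k + 1) * 3 :=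
    mul_le_mul h1 hμ3 hμ.le (by positivity)
  have e2 : ((k : ℝ) + 1) * Real.exp (6 * s) * bridgeCount 2 (k + 1) * 3 ≤
      Real.exp (12 * s) * bridgeCount 2 (k + 1) := by
    have h12 : Real.exp (12 * s) = Real.exp (6 * s) * Real.exp (6 * s) := by rw [← Real.exp_add]; ring_nf
    rw [h12]
    have := mul_le_mul_of_nonneg_left hexp (mul_nonneg (Real.exp_nonneg (6 * s)) hb0)
    nlinarith
  have e3 := e1.trans e2
  rw [Real.exp_neg, inv_mul_le_iff₀ (Real.exp_pos _)]
  linarith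

section Data

/-- `b_n > 0` on `ℤ²` (real form). [folklore] -/
private theorem hb2 (n : ℕ) : (0 : ℝ) < (bridgeCount 2 n : ℝ) := by exact_mod_cast one_le_bridgeCount (d := 2) n

/-- Supermultiplicativity `b_n b_m ≤ b_{n+m}` on `ℤ²` (real form). [folklore] -/
private theorem hsup2 (n m : ℕ) : (bridgeCount 2 n : ℝ) * (bridgeCount 2 m : ℝ) ≤ (bridgeCount 2 (n + m) : ℝ) := by
  exact_mod_cast bridgeCount_mul_le (d := 2) n m

/-- `b_{n+2}/b_n ≥ 1` on `ℤ²` (real form). [folklore] -/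
private theorem hone2 (n : ℕ) : (1 : ℝ) ≤ (bridgeCount 2 (n + 2) : ℝ) / bridgeCount 2 n := by
  rw [le_div_iff₀ (hb2 n), one_mul]; exact_mod_cast bridgeCount_le_add_two (d' := 2) n

end Data

/-- Upper core: from `M log(1 + u/(2μ²)) ≤ 12√N` and `M ≥ uN/(2B) - 1`: `u N^{1/4} ≤ 10 μ √B + 37 B`. [folklore] -/
private theorem upper_explicit_core {μ B u : ℝ} {N M : ℕ} (hμ : 0 < μ) (hB : 0 < B) (hu : 0 < u) (hN : 1 ≤ N)
    (hMge : u * N / (2 * B) - 1 ≤ M) (hlem : (M : ℝ) * Real.log (1 + u / (2 * μ ^ 2)) ≤ 12 * Real.sqrt N) :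
    u * (N : ℝ) ^ ((1 : ℝ) / 4) ≤ 10 * μ * Real.sqrt B + 37 * B := by
  have hNr : (1 : ℝ) ≤ N := by exact_mod_cast hN
  have hN0 : (0 : ℝ) < N := by linarith
  obtain ⟨t, ht⟩ : ∃ t : ℝ, t = (N : ℝ) ^ ((1 : ℝ) / 4) := ⟨_, rfl⟩
  rw [← ht]
  have ht0 : 0 < t := by rw [ht]; exact Real.rpow_pos_of_pos hN0 _
  have ht1 : 1 ≤ t := by rw [ht]; exact Real.one_le_rpow hNr (by norm_num)
  have ht2 : t ^ 2 = Real.sqrt N := by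
    rw [ht, ← Real.rpow_natCast, ← Real.rpow_mul hN0.le, Real.sqrt_eq_rpow]; norm_num
  have hsN0 : 0 < Real.sqrt N := Real.sqrt_pos.2 hN0
  have hsN1 : 1 ≤ Real.sqrt N := by rw [← ht2]; exact one_le_pow₀ ht1
  have htle : t ≤ Real.sqrt N := by rw [← ht2]; nlinarith
  have hNsq : Real.sqrt N * Real.sqrt N = N := Real.mul_self_sqrt hN0.le
  have hsB : 0 ≤ Real.sqrt B := Real.sqrt_nonneg B
  obtain ⟨x, hx⟩ : ∃ x : ℝ, x = u / (2 * μ ^ 2) := ⟨_, rfl⟩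
  have hx0 : 0 < x := by rw [hx]; positivity
  rw [← hx] at hlem
  have hxu : x * (2 * μ ^ 2) = u := by rw [hx]; exact div_mul_cancel₀ _ (by positivity)
  have hdB : u * N / (2 * B) * (2 * B) = u * N := div_mul_cancel₀ _ (by positivity)
  by_cases hx1 : x ≤ 1
  · have hlogx := half_le_log_one_add' hx0.le hx1
    have hMx : (M : ℝ) * x ≤ 24 * Real.sqrt N := by
      have := mul_le_mul_of_nonneg_left hlogx (Nat.cast_nonneg M); linarith
    have h3 : (u * N / (2 * B) - 1) * x ≤ 24 * Real.sqrt N := by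
      have := mul_le_mul_of_nonneg_right hMge hx0.le; linarith
    have h4 : u * N / (2 * B) * x ≤ 25 * Real.sqrt N := by linarith
    have h5 : u * N * u ≤ 100 * μ ^ 2 * B * Real.sqrt N := by
      have := mul_le_mul_of_nonneg_right h4 (show (0 : ℝ) ≤ 2 * B * (2 * μ ^ 2) by positivity)
      have e : u * N / (2 * B) * x * (2 * B * (2 * μ ^ 2)) = u * N * u := by
        linear_combination (x * (2 * μ ^ 2)) * hdB + (u * N) * hxu
      rw [e] at this; linarith
    have h6 : u ^ 2 * Real.sqrt N ≤ 100 * μ ^ 2 * B := by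
      refine le_of_mul_le_mul_right ?_ hsN0
      have e : u ^ 2 * Real.sqrt N * Real.sqrt N = u * N * u := by rw [mul_assoc, hNsq]; ring
      rw [e]; linarith
    have h7 : (u * t) ^ 2 ≤ (10 * μ * Real.sqrt B) ^ 2 := by
      rw [mul_pow, ht2, mul_pow, mul_pow, Real.sq_sqrt hB.le]; linarith
    have h8 : u * t ≤ 10 * μ * Real.sqrt B := le_of_pow_le_pow_left₀ (by norm_num) (by positivity) h7
    linarith [mul_nonneg (by norm_num : (0:ℝ) ≤ 37) hB.le]
  · rw [not_le] at hx1
    have hlog2 : Real.log 2 ≤ Real.log (1 + x) := Real.log_le_log (by norm_num) (by linarith)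
    have hl2 : (0.6931471803 : ℝ) < Real.log 2 := Real.log_two_gt_d9
    have hl2p : 0 < Real.log 2 := by linarith
    have hM2 : (M : ℝ) * Real.log 2 ≤ 12 * Real.sqrt N := by
      have := mul_le_mul_of_nonneg_left hlog2 (Nat.cast_nonneg M); linarith
    have h3 : (u * N / (2 * B) - 1) * Real.log 2 ≤ 12 * Real.sqrt N := by
      have := mul_le_mul_of_nonneg_right hMge hl2p.le; linarith
    have h5 : u * N / (2 * B) ≤ 18.5 * Real.sqrt N := by
      have h4a : u * N / (2 * B) ≤ (12 * Real.sqrt N + Real.log 2) / Real.log 2 := by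
        rw [le_div_iff₀ hl2p]; linarith
      have h4b : (12 * Real.sqrt N + Real.log 2) / Real.log 2 = 12 * Real.sqrt N / Real.log 2 + 1 := by
        field_simp
      have h4c : 12 * Real.sqrt N / Real.log 2 ≤ 12 * Real.sqrt N / 0.6931471803 :=
        div_le_div_of_nonneg_left (by positivity) (by norm_num) hl2.le
      have h4d : 12 * Real.sqrt N / 0.6931471803 ≤ 17.5 * Real.sqrt N := by
        rw [div_le_iff₀ (by norm_num)]; nlinarith
      linarith
    have h6 : u * N ≤ 37 * B * Real.sqrt N := by
      have := mul_le_mul_of_nonneg_right h5 (show (0:ℝ) ≤ 2 * B by positivity)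
      rw [hdB] at this; linarith
    have h7 : u * Real.sqrt N ≤ 37 * B := by
      refine le_of_mul_le_mul_right ?_ hsN0
      rw [mul_assoc, hNsq]; exact h6
    have h8 : u * t ≤ u * Real.sqrt N := mul_le_mul_of_nonneg_left htle hu.le
    have h9 : 0 ≤ 10 * μ * Real.sqrt B := by positivity
    linarith

/-- Lower core, case `M = ⌊N/4⌋`: from `M u² ≤ 1152 μ⁴` and `N ≤ 8M`: `u √N ≤ 96 μ²`. [folklore] -/
private theorem lower_core_L2 {μ u : ℝ} {N M : ℕ} (hμ : 0 < μ) (hN : 1 ≤ N)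
    (hstep : (M : ℝ) * u ^ 2 ≤ 1152 * μ ^ 4) (hM8 : (N : ℝ) ≤ 8 * M) : u * Real.sqrt N ≤ 96 * μ ^ 2 := by
  have hN0 : (0 : ℝ) < N := by exact_mod_cast (show 0 < N by omega)
  have h1 : u ^ 2 * N ≤ 9216 * μ ^ 4 := by nlinarith [sq_nonneg u]
  have h2 : (u * Real.sqrt N) ^ 2 ≤ (96 * μ ^ 2) ^ 2 := by
    rw [mul_pow, Real.sq_sqrt hN0.le]; nlinarith [pow_pos hμ 4]
  exact le_of_pow_le_pow_left₀ (by norm_num) (by positivity) h2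

/-- Lower core, case `M = ⌊uN/(4B)⌋ ≥ uN/(8B)`: `u N^{1/3} ≤ 21 μ^{4/3} B^{1/3}`. [folklore] -/
private theorem lower_core_L1 {μ B u s : ℝ} {N M : ℕ} (hμ : 0 < μ) (hB : 0 < B)
    (hs3 : s ^ 3 = N) (hstep : (M : ℝ) * u ^ 2 ≤ 1152 * μ ^ 4) (hMhalf : u * N / (8 * B) ≤ M) :
    u * s ≤ 21 * μ ^ ((4 : ℝ) / 3) * B ^ ((1 : ℝ) / 3) := by
  have hC1 : 0 ≤ 21 * μ ^ ((4 : ℝ) / 3) * B ^ ((1 : ℝ) / 3) := by positivity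
  have h1 : u * N / (8 * B) * u ^ 2 ≤ 1152 * μ ^ 4 := by
    have := mul_le_mul_of_nonneg_right hMhalf (sq_nonneg u); linarith
  have hd8 : u * N / (8 * B) * (8 * B) = u * N := div_mul_cancel₀ _ (by positivity)
  have h2 : u ^ 3 * N ≤ 9216 * μ ^ 4 * B := by
    have := mul_le_mul_of_nonneg_right h1 (show (0 : ℝ) ≤ 8 * B by positivity)
    have e : u * N / (8 * B) * u ^ 2 * (8 * B) = u ^ 3 * N := by linear_combination (u ^ 2) * hd8
    rw [e] at this; linarith
  have h3 : (u * s) ^ 3 ≤ 9216 * μ ^ 4 * B := by rw [mul_pow, hs3]; exact h2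
  have e1 : (μ ^ ((4 : ℝ) / 3)) ^ 3 = μ ^ 4 := by
    rw [← Real.rpow_natCast (μ ^ ((4 : ℝ) / 3)), ← Real.rpow_mul hμ.le]
    rw [show (4 : ℝ) / 3 * ((3 : ℕ) : ℝ) = ((4 : ℕ) : ℝ) by norm_num, Real.rpow_natCast]
  have e2 : (B ^ ((1 : ℝ) / 3)) ^ 3 = B := by
    rw [one_div, show (3 : ℝ) = ((3 : ℕ) : ℝ) by norm_num, Real.rpow_inv_natCast_pow hB.le (by norm_num)]
  have hK3 : (21 * μ ^ ((4 : ℝ) / 3) * B ^ ((1 : ℝ) / 3)) ^ 3 = 9261 * μ ^ 4 * B := by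
    rw [mul_pow, mul_pow, e1, e2]; norm_num
  have hμB : 0 ≤ μ ^ 4 * B := by positivity
  have h4 : (u * s) ^ 3 ≤ (21 * μ ^ ((4 : ℝ) / 3) * B ^ ((1 : ℝ) / 3)) ^ 3 := by rw [hK3]; linarith
  exact le_of_pow_le_pow_left₀ (by norm_num) hC1 h4

/-- **Upper side, explicit, every `N ≥ 1`**: `b_{N+2}/b_N - μ² ≤ (10 μ √B + 37 B) N^{-1/4}`.
[cite: MadrasSlade1993, Theorem 7.3.4(d), eq. (7.3.13); §7.5 eq. (7.5.2)] -/
theorem twoStep_upper_explicit_Z2 {B : ℝ} (hB : 0 < B) (hK : KestenIneqBridgesZ2 B) {N : ℕ} (hN : 1 ≤ N) :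
    (bridgeCount 2 (N + 2) : ℝ) / bridgeCount 2 N - connectiveConstant 2 ^ 2 ≤
      (10 * connectiveConstant 2 * Real.sqrt B + 37 * B) * (N : ℝ) ^ (-(1 : ℝ) / 4) := by
  obtain ⟨μ, hμdef⟩ : ∃ μ : ℝ, μ = connectiveConstant 2 := ⟨_, rfl⟩
  have hμ : 0 < μ := by rw [hμdef]; exact connectiveConstant_pos 2
  rw [← hμdef]
  obtain ⟨φ, hφ⟩ : ∃ φ : ℝ, φ = (bridgeCount 2 (N + 2) : ℝ) / bridgeCount 2 N := ⟨_, rfl⟩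
  rw [← hφ]
  have hNr : (1 : ℝ) ≤ N := by exact_mod_cast hN
  have hN0 : (0 : ℝ) < N := by linarith
  have hr4 : 0 ≤ (N : ℝ) ^ (-(1 : ℝ) / 4) := by positivity
  have hsB : 0 ≤ Real.sqrt B := Real.sqrt_nonneg B
  by_cases hupos : φ - μ ^ 2 ≤ 0
  · have : 0 ≤ (10 * μ * Real.sqrt B + 37 * B) * (N : ℝ) ^ (-(1 : ℝ) / 4) := by positivity
    linarith
  rw [not_le] at hupos
  obtain ⟨u, hu⟩ : ∃ u : ℝ, u = φ - μ ^ 2 := ⟨_, rfl⟩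
  rw [← hu] at hupos ⊢
  -- `M = ⌊uN/(2B)⌋`
  obtain ⟨M, hMdef⟩ : ∃ M : ℕ, M = Nat.floor (u * N / (2 * B)) := ⟨_, rfl⟩
  have hMle : (M : ℝ) ≤ u * N / (2 * B) := by rw [hMdef]; exact Nat.floor_le (by positivity)
  have hMge : u * N / (2 * B) - 1 ≤ M := by
    have := Nat.lt_floor_add_one (u * N / (2 * B)); rw [← hMdef] at this; linarith
  have hMD : (M : ℝ) * B ≤ u * N / 2 := by
    have h1 : (M : ℝ) * (2 * B) ≤ u * N := by rwa [le_div_iff₀ (by positivity)] at hMle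
    linarith
  have hhi : ∀ n : ℕ, (bridgeCount 2 n : ℝ) ≤ μ ^ n := fun n => by rw [hμdef]; exact bridgeCount_le_pow (d := 2) n
  have hlo : Real.exp (-(12 * Real.sqrt N)) * μ ^ N ≤ bridgeCount 2 N := by rw [hμdef]; exact bridge_envelope_Z2 N
  have hdev : μ ^ 2 + u ≤ (bridgeCount 2 (N + 2) : ℝ) / bridgeCount 2 N := by rw [← hφ, hu]; linarith
  have hlem := upper_dev_env (b := fun n => (bridgeCount 2 n : ℝ)) (N₁ := 1) hb2 hμ hB.le hK hhi hlo hN hN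
    hupos hdev hMD
  have hN0 : (0 : ℝ) < N := by positivity
  have hut := upper_explicit_core (M := M) hμ hB hupos hN hMge hlem
  have ht0 : 0 < (N : ℝ) ^ ((1 : ℝ) / 4) := Real.rpow_pos_of_pos hN0 _
  have e : (N : ℝ) ^ (-(1 : ℝ) / 4) = ((N : ℝ) ^ ((1 : ℝ) / 4))⁻¹ := by rw [← Real.rpow_neg hN0.le]; norm_num
  rw [e]
  rw [← le_div_iff₀ ht0, div_eq_mul_inv] at hut
  exact hut

/-- The common step of the lower side: from `-M log(1 - u/(2μ²)) ≤ 12 √(2M)`: `M u² ≤ 1152 μ⁴`. [folklore] -/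
private theorem lower_step {μ u : ℝ} {M : ℕ} (hμ : 0 < μ) (hu : 0 < u) (huμ : u ≤ μ ^ 2)
    (hlem : -((M : ℝ) * Real.log (1 - u / (2 * μ ^ 2))) ≤ 12 * Real.sqrt ((2 * M : ℕ) : ℝ)) :
    (M : ℝ) * u ^ 2 ≤ 1152 * μ ^ 4 := by
  obtain ⟨x, hx⟩ : ∃ x : ℝ, x = u / (2 * μ ^ 2) := ⟨_, rfl⟩
  have hx0 : 0 < x := by rw [hx]; positivity
  have hx1 : x < 1 := by rw [hx, div_lt_one (by positivity)]; nlinarith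
  have hxu : x * (2 * μ ^ 2) = u := by rw [hx]; exact div_mul_cancel₀ _ (by positivity)
  rw [← hx] at hlem
  have hMx : (M : ℝ) * x ≤ 12 * Real.sqrt ((2 * M : ℕ) : ℝ) := by
    have := mul_le_mul_of_nonneg_left (le_neg_log_one_sub' hx1) (Nat.cast_nonneg M); linarith
  have hM2 : (M : ℝ) * x ^ 2 ≤ 288 := by
    rcases Nat.eq_zero_or_pos M with hM0 | hMpos
    · rw [hM0, Nat.cast_zero, zero_mul]; norm_num
    have hMr : (0 : ℝ) < M := by exact_mod_cast hMpos
    have hsq : ((M : ℝ) * x) ^ 2 ≤ (12 * Real.sqrt ((2 * M : ℕ) : ℝ)) ^ 2 := pow_le_pow_left₀ (by positivity) hMx 2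
    rw [mul_pow, mul_pow, Real.sq_sqrt (by positivity)] at hsq
    push_cast at hsq
    nlinarith
  have e : (M : ℝ) * x ^ 2 * (4 * μ ^ 4) = M * u ^ 2 := by
    linear_combination ((M : ℝ) * (x * (2 * μ ^ 2) + u)) * hxu
  have := mul_le_mul_of_nonneg_right hM2 (show (0:ℝ) ≤ 4 * μ ^ 4 by positivity)
  rw [e] at this; linarith

/-- **Lower side, explicit, every `N ≥ 1`**:
`-(21 μ^{4/3} B^{1/3} + 4B + 96 μ²) N^{-1/3} ≤ b_{N+2}/b_N - μ²`.
[cite: MadrasSlade1993, Theorem 7.3.4(d), eq. (7.3.13); §7.5 eq. (7.5.2)] -/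
theorem twoStep_lower_explicit_Z2 {B : ℝ} (hB : 0 < B) (hK : KestenIneqBridgesZ2 B) {N : ℕ} (hN : 1 ≤ N) :
    -(21 * connectiveConstant 2 ^ ((4 : ℝ) / 3) * B ^ ((1 : ℝ) / 3) + 4 * B +
        96 * connectiveConstant 2 ^ 2) * (N : ℝ) ^ (-(1 : ℝ) / 3) ≤
      (bridgeCount 2 (N + 2) : ℝ) / bridgeCount 2 N - connectiveConstant 2 ^ 2 := by
  obtain ⟨μ, hμdef⟩ : ∃ μ : ℝ, μ = connectiveConstant 2 := ⟨_, rfl⟩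
  have hμ : 0 < μ := by rw [hμdef]; exact connectiveConstant_pos 2
  rw [← hμdef]
  obtain ⟨φ, hφ⟩ : ∃ φ : ℝ, φ = (bridgeCount 2 (N + 2) : ℝ) / bridgeCount 2 N := ⟨_, rfl⟩
  rw [← hφ]
  have hφ1 : 1 ≤ φ := by rw [hφ]; exact hone2 N
  have hNr : (1 : ℝ) ≤ N := by exact_mod_cast hN
  have hN0 : (0 : ℝ) < N := by linarith
  -- `s = N^{1/3}`, `s³ = N`, `1 ≤ s ≤ √N ≤ N`
  obtain ⟨s, hs⟩ : ∃ s : ℝ, s = (N : ℝ) ^ ((1 : ℝ) / 3) := ⟨_, rfl⟩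
  have hs0 : 0 < s := by rw [hs]; exact Real.rpow_pos_of_pos hN0 _
  have hs1 : 1 ≤ s := by rw [hs]; exact Real.one_le_rpow hNr (by norm_num)
  have hs3 : s ^ 3 = N := by
    rw [hs, ← Real.rpow_natCast, ← Real.rpow_mul hN0.le]; norm_num
  have hsN : s ≤ N := by
    rw [hs]; nth_rw 2 [← Real.rpow_one (N : ℝ)]
    exact Real.rpow_le_rpow_of_exponent_le hNr (by norm_num)
  have hsqN : s ≤ Real.sqrt N := by
    rw [hs, Real.sqrt_eq_rpow]; exact Real.rpow_le_rpow_of_exponent_le hNr (by norm_num)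
  have hsN0 : 0 < Real.sqrt N := Real.sqrt_pos.2 hN0
  have hNsq : Real.sqrt N * Real.sqrt N = N := Real.mul_self_sqrt hN0.le
  -- the constant and its pieces
  have hC1 : 0 ≤ 21 * μ ^ ((4 : ℝ) / 3) * B ^ ((1 : ℝ) / 3) := by positivity
  have hC3 : 0 ≤ 96 * μ ^ 2 := by positivity
  have hr3 : 0 ≤ (N : ℝ) ^ (-(1 : ℝ) / 3) := by positivity
  by_cases hupos : μ ^ 2 - φ ≤ 0
  · have : 0 ≤ (21 * μ ^ ((4 : ℝ) / 3) * B ^ ((1 : ℝ) / 3) + 4 * B + 96 * μ ^ 2) * (N : ℝ) ^ (-(1 : ℝ) / 3) := by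
      positivity
    linarith
  rw [not_le] at hupos
  obtain ⟨u, hu⟩ : ∃ u : ℝ, u = μ ^ 2 - φ := ⟨_, rfl⟩
  rw [← hu] at hupos
  have huμ : u ≤ μ ^ 2 := by rw [hu]; linarith
  have hhi : ∀ n : ℕ, (bridgeCount 2 n : ℝ) ≤ μ ^ n := fun n => by rw [hμdef]; exact bridgeCount_le_pow (d := 2) n
  have hlo : ∀ n : ℕ, Real.exp (-(12 * Real.sqrt n)) * μ ^ n ≤ bridgeCount 2 n := fun n => by
    rw [hμdef]; exact bridge_envelope_Z2 n
  -- the bound `u s ≤ 21 μ^{4/3} B^{1/3} + 4B + 96 μ²`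
  have hus : u * s ≤ 21 * μ ^ ((4 : ℝ) / 3) * B ^ ((1 : ℝ) / 3) + 4 * B + 96 * μ ^ 2 := by
    by_cases hL1b : u * N < 4 * B
    · -- Case L1b
      have : u * s ≤ u * N := mul_le_mul_of_nonneg_left hsN hupos.le
      linarith
    rw [not_lt] at hL1b
    by_cases hL2 : B < u
    · -- Case L2: `M = ⌊N/4⌋`
      rcases Nat.lt_or_ge N 4 with hN4 | hN4
      · -- `N ≤ 3`: `u s ≤ μ² · N ≤ 3 μ²`
        have hN3 : (N : ℝ) ≤ 3 := by exact_mod_cast (show N ≤ 3 by omega)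
        have : u * s ≤ μ ^ 2 * 3 := by
          calc u * s ≤ μ ^ 2 * s := mul_le_mul_of_nonneg_right huμ hs0.le
            _ ≤ μ ^ 2 * 3 := mul_le_mul_of_nonneg_left (hsN.trans hN3) (by positivity)
        linarith
      obtain ⟨M, hMdef⟩ : ∃ M : ℕ, M = N / 4 := ⟨_, rfl⟩
      have hM8 : N ≤ 8 * M := by omega
      have hM4 : 4 * M ≤ N := by omega
      obtain ⟨N', hN'def⟩ : ∃ N' : ℕ, N' = N - 2 * M := ⟨_, rfl⟩
      have hN'eq : N' + 2 * M = N := by omega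
      have hN'1 : 1 ≤ N' := by omega
      have hN'half : (N : ℝ) ≤ 2 * N' := by exact_mod_cast (show N ≤ 2 * N' by omega)
      have hMr : 4 * (M : ℝ) ≤ N := by exact_mod_cast hM4
      have hMD : 2 * (M : ℝ) * B ≤ u * N' := by nlinarith
      have hdev : (bridgeCount 2 (N' + 2 * M + 2) : ℝ) / bridgeCount 2 (N' + 2 * M) ≤ μ ^ 2 - u := by
        rw [hN'eq, ← hφ, hu]; linarith
      have hlem := lower_dev_supermult (b := fun n => (bridgeCount 2 n : ℝ)) (N₁ := 1) hb2 hμ hB.le hK hsup2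
        (hlo (2 * M)) hN'1 hN'1 hupos huμ hdev hMD
      have hstep := lower_step hμ hupos huμ hlem
      have hM8r : (N : ℝ) ≤ 8 * M := by exact_mod_cast hM8
      have h3 := lower_core_L2 hμ hN hstep hM8r
      have h4 : u * s ≤ u * Real.sqrt N := mul_le_mul_of_nonneg_left hsqN hupos.le
      linarith
    · -- Case L1a: `u ≤ B`, `uN ≥ 4B`; `M = ⌊uN/(4B)⌋ ≥ 1`
      rw [not_lt] at hL2
      have hy1 : 1 ≤ u * N / (4 * B) := by rw [le_div_iff₀ (by positivity)]; linarith
      obtain ⟨M, hMdef⟩ : ∃ M : ℕ, M = Nat.floor (u * N / (4 * B)) := ⟨_, rfl⟩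
      have hMle : (M : ℝ) ≤ u * N / (4 * B) := by rw [hMdef]; exact Nat.floor_le (by positivity)
      have hM1 : 1 ≤ M := by rw [hMdef]; exact Nat.one_le_floor_iff _ |>.2 hy1
      have hMge : u * N / (4 * B) - 1 ≤ M := by
        have := Nat.lt_floor_add_one (u * N / (4 * B)); rw [← hMdef] at this; linarith
      -- `M ≥ uN/(8B)` (as `⌊y⌋ ≥ y/2` for `y ≥ 1`)
      have hMhalf : u * N / (8 * B) ≤ M := by
        have hM1r : (1 : ℝ) ≤ M := by exact_mod_cast hM1
        by_cases hy2 : u * N / (4 * B) ≤ 2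
        · have : u * N / (8 * B) = (u * N / (4 * B)) / 2 := by field_simp; ring
          rw [this]; linarith
        · rw [not_le] at hy2
          have : u * N / (8 * B) = (u * N / (4 * B)) / 2 := by field_simp; ring
          rw [this]; linarith
      have hM4 : 4 * (M : ℝ) ≤ N := by
        have : u * N / (4 * B) ≤ N / 4 := by
          rw [div_le_div_iff₀ (by positivity) (by norm_num)]; nlinarith
        linarith
      have hM4' : 4 * M ≤ N := by exact_mod_cast hM4
      obtain ⟨N', hN'def⟩ : ∃ N' : ℕ, N' = N - 2 * M := ⟨_, rfl⟩
      have hN'eq : N' + 2 * M = N := by omega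
      have hN'1 : 1 ≤ N' := by omega
      have hN'half : (N : ℝ) ≤ 2 * N' := by exact_mod_cast (show N ≤ 2 * N' by omega)
      have hMD : 2 * (M : ℝ) * B ≤ u * N' := by
        have h1 : (M : ℝ) * (4 * B) ≤ u * N := by rwa [le_div_iff₀ (by positivity)] at hMle
        nlinarith
      have hdev : (bridgeCount 2 (N' + 2 * M + 2) : ℝ) / bridgeCount 2 (N' + 2 * M) ≤ μ ^ 2 - u := by
        rw [hN'eq, ← hφ, hu]; linarith
      have hlem := lower_dev_supermult (b := fun n => (bridgeCount 2 n : ℝ)) (N₁ := 1) hb2 hμ hB.le hK hsup2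
        (hlo (2 * M)) hN'1 hN'1 hupos huμ hdev hMD
      have hstep := lower_step hμ hupos huμ hlem
      have h5 := lower_core_L1 hμ hB hs3 hstep hMhalf
      linarith
  have e : (N : ℝ) ^ (-(1 : ℝ) / 3) = s⁻¹ := by rw [hs, ← Real.rpow_neg hN0.le]; norm_num
  rw [e]
  have h := mul_le_mul_of_nonneg_right hus (inv_nonneg.2 hs0.le)
  rw [mul_assoc, mul_inv_cancel₀ hs0.ne', mul_one, hu] at h
  linarith

end Literature.Probability.RandomPlanarGeometry.SAW.Zd
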